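import Mathlib
import Literature.Computability.AlgebraicComplexity.NewtonPolygonTauProductBounds
import Summits.ValiantsHypothesis.ValiantsHypothesis.Theorems.NewtonUnitEquationsDissociatedUniformTotalsLawDominance
import Summits.ValiantsHypothesis.ValiantsHypothesis.Theorems.NewtonUnitEquationsDissociatedUniformTotalsLawGridDominance
import HarnessLib

/-!
# Crux `NewtonUnitEquations.DissociatedUniform` (stmt-ValiantsHypothesis-5905), `n = 3` totals law of model (Q**):
# SUB-GRID DOMINANCE — the form of the located log-free rung consumed by the box strata (`GridDominanceSubBound C`)

Memo `Cruxes/DissociatedUniform/NOTES-t1g18.md` §3; companion of `…TotalsLawGridDominance` (`Stair.gridPts`, `GridDominanceBound C`).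
The block reduction of `…TotalsLawBoxWindows` / `…BoxUnion` / `…BohrBox` meets partial blocks and four offset types, so rows and
columns of the dominance pieces range over SUBSETS of the key grid `[m₁] × [m₂]`.  This file types that form:
* `Stair.gridPtsSub R C v b` — `{v k + b c : k ∈ R, c ∈ C, k ≤ c}` for `R, C ⊆ Fin m₁ × Fin m₂`;
* `@[conjecture] GridDominanceSubBound C` — `#vert conv(gridPtsSub) ≤ C·m₁m₂` (OPEN; bound = grid AREA; for `#R + #C` in place of the
  area the statement is false asymptotically, memo §2); `gridDominanceBound_of_sub` (it contains `GridDominanceBound C`);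
* `Stair.ncard_extremePoints_gridPtsSub_le_log` — the PROVED `log` form `≤ 4·size(2(m₁m₂+1)(m₂+1))·(#R + #C)` (an instance of
  `…Dominance.Stair.ncard_extremePoints_domPts_le_size` with the lexicographic codes of `…GridDominance`).
Honest label: a located conjecture-grade statement plus its known `log` form; `UnionTotalsLaw C`, `TriWordsBound C`, `TotalsLawThree C`
remain OPEN and are asserted nowhere; nothing here bears on VP ≠ VNP. [folklore]
-/

set_option linter.dupNamespace false -- `ValiantsHypothesis.ValiantsHypothesis` (summit = problem) in every name

open Finset Matrix
open scoped Pointwise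

namespace Summit.ValiantsHypothesis.ValiantsHypothesis.Theorems.NewtonUnitEquationsDissociatedUniform

namespace TotalsLaw

/-! ### The sub-grid form of the rung

The block reduction of the box strata meets PARTIAL blocks and the four offset types (`≤` / `>` per coordinate, which become `≤` after
reflecting and shifting an index), so the form of the rung they consume lets rows and columns range over SUBSETS of the grid:
`GridDominanceSubBound C`.  It implies `GridDominanceBound C`; its `log` form is again an instance of `…Dominance`.  The memo
(`NOTES-t1g18.md` §3) records why the Wiernik–Sharir mechanism does not refute it (an embedded envelope of `n` segments needs an
antichain of `≈ 2n` columns, hence a grid of area `≈ n²`). -/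

namespace Stair

open Literature.Computability.AlgebraicComplexity.KPTT.PlanarMinkowski

variable {m₁ m₂ : ℕ}

/-- The SUB-GRID dominance sum: rows `k ∈ R`, columns `c ∈ C` (subsets of the grid), relation `k ≤ c` coordinatewise. -/
noncomputable def gridPtsSub (R C : Finset (Fin m₁ × Fin m₂)) (v b : Fin m₁ × Fin m₂ → (Fin 2 → ℝ)) : Finset (Fin 2 → ℝ) :=
  ((R ×ˢ C).filter fun p => p.1.1 ≤ p.2.1 ∧ p.1.2 ≤ p.2.2).image fun p => v p.1 + b p.2

/-- Membership in `gridPtsSub`. [folklore] -/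
theorem mem_gridPtsSub {R C : Finset (Fin m₁ × Fin m₂)} {v b : Fin m₁ × Fin m₂ → (Fin 2 → ℝ)} {x : Fin 2 → ℝ} :
    x ∈ gridPtsSub R C v b ↔ ∃ k ∈ R, ∃ c ∈ C, k.1 ≤ c.1 ∧ k.2 ≤ c.2 ∧ v k + b c = x := by
  constructor
  · intro hx
    obtain ⟨p, hp, rfl⟩ := Finset.mem_image.1 hx
    obtain ⟨hRC, h1, h2⟩ := Finset.mem_filter.1 hp
    obtain ⟨hk, hc⟩ := Finset.mem_product.1 hRC
    exact ⟨p.1, hk, p.2, hc, h1, h2, rfl⟩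
  · rintro ⟨k, hk, c, hc, h1, h2, rfl⟩
    exact Finset.mem_image.2 ⟨(k, c), Finset.mem_filter.2 ⟨Finset.mem_product.2 ⟨hk, hc⟩, h1, h2⟩, rfl⟩

/-- The full grid is the sub-grid sum over `univ × univ`. [folklore] -/
theorem gridPtsSub_univ (v b : Fin m₁ × Fin m₂ → (Fin 2 → ℝ)) :
    gridPtsSub Finset.univ Finset.univ v b = gridPts m₁ m₂ v b := by
  ext x
  rw [mem_gridPtsSub, mem_gridPts]
  constructor
  · rintro ⟨k, -, c, -, h1, h2, h⟩; exact ⟨k, c, h1, h2, h⟩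
  · rintro ⟨k, c, h1, h2, h⟩; exact ⟨k, Finset.mem_univ _, c, Finset.mem_univ _, h1, h2, h⟩

/-- **The sub-grid sum is a dominance sum.** [folklore] -/
theorem gridPtsSub_eq_domPts (R C : Finset (Fin m₁ × Fin m₂)) (v b : Fin m₁ × Fin m₂ → (Fin 2 → ℝ)) :
    gridPtsSub R C v b = domPts R C gRow₂ gRow₁' gCol₂ gCol₁' v b := by
  ext x
  rw [mem_gridPtsSub, mem_domPts]
  constructor
  · rintro ⟨k, hk, c, hc, h1, h2, h⟩
    exact ⟨k, hk, c, hc, (gRow₂_lt_gCol₂_iff k c).2 h2, (gRow₁'_lt_gCol₁'_iff k c).2 h1, h⟩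
  · rintro ⟨k, hk, c, hc, h2, h1, h⟩
    exact ⟨k, hk, c, hc, (gRow₁'_lt_gCol₁'_iff k c).1 h1, (gRow₂_lt_gCol₂_iff k c).1 h2, h⟩

/-- **The `log` form for sub-grids (proved):** `#vert conv(gridPtsSub R C v b) ≤ 4·size(2(m₁m₂+1)(m₂+1))·(#R + #C)`. [folklore] -/
theorem ncard_extremePoints_gridPtsSub_le_log (R C : Finset (Fin m₁ × Fin m₂)) (v b : Fin m₁ × Fin m₂ → (Fin 2 → ℝ)) :
    ((convexHull ℝ (gridPtsSub R C v b : Set (Fin 2 → ℝ))).extremePoints ℝ).ncard ≤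
      4 * Nat.size (2 * (m₁ * m₂ + 1) * (m₂ + 1)) * (R.card + C.card) := by
  classical
  rw [gridPtsSub_eq_domPts]
  exact ncard_extremePoints_domPts_le_size (R := R) (C := C) (ρ₁ := gRow₂) (γ₁ := gCol₂) (v := v) (b := b)
    gRow₁'_injective gCol₁'_injective (2 * (m₁ * m₂ + 1) * (m₂ + 1)) fun c _ => gCol₂_lt c

end Stair

/-- **The sub-grid dominance bound** (conjecture-grade, OPEN; the form consumed by the block reduction of the box strata, memo
`NOTES-t1g18.md` §3): for all grid sizes, all row / column SUBSETS of the grid and all point assignments,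
`#vert conv {v k + b c : k ∈ R, c ∈ C, k ≤ c} ≤ C·m₁m₂` (the bound is the grid AREA, not `#R + #C` — for `#R + #C` the statement is
false asymptotically, memo §2).  Not asserted anywhere. -/
@[conjecture] def GridDominanceSubBound (C : ℕ) : Prop :=
  ∀ (m₁ m₂ : ℕ) (R Cset : Finset (Fin m₁ × Fin m₂)) (v b : Fin m₁ × Fin m₂ → (Fin 2 → ℝ)),
    ((convexHull ℝ (Stair.gridPtsSub R Cset v b : Set (Fin 2 → ℝ))).extremePoints ℝ).ncard ≤ C * (m₁ * m₂)

/-- Monotonicity in the constant. -/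
theorem gridDominanceSubBound_mono {C C' : ℕ} (hCC' : C ≤ C') (h : GridDominanceSubBound C) : GridDominanceSubBound C' :=
  fun m₁ m₂ R Cset v b => (h m₁ m₂ R Cset v b).trans (Nat.mul_le_mul_right _ hCC')

/-- The sub-grid rung contains the full-grid rung. -/
theorem gridDominanceBound_of_sub {C : ℕ} (h : GridDominanceSubBound C) : GridDominanceBound C := by
  intro m₁ m₂ v b
  rw [← Stair.gridPtsSub_univ]
  exact h m₁ m₂ Finset.univ Finset.univ v b

/-- `C = 0` fails for the sub-grid rung as well. -/
theorem not_gridDominanceSubBound_zero : ¬ GridDominanceSubBound 0 :=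
  fun h => not_gridDominanceBound_zero (gridDominanceBound_of_sub h)

end TotalsLaw

end Summit.ValiantsHypothesis.ValiantsHypothesis.Theorems.NewtonUnitEquationsDissociatedUniform
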